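import Summits.CriticalPhenomena.PercolationContinuityZ3.Theorems.PercNearOneGluingNoHeavyLowerTailStarSetFamilyA0
import Summits.CriticalPhenomena.PercolationContinuityZ3.Theorems.PercNearOneGluingNoHeavyLowerTailStarSetLoadRegular
import HarnessLib

/-!
# `NoHeavyLowerTail` (stmt-CriticalPhenomena-4575) — the regular family of the unit bound, per class-set (U1-PROOF §3; blueprint §C/§F2/§G)

Support file (prover `prim-gen-swap` gen 13; `--supports stmt-CriticalPhenomena-4575`).  No definitions, no named facts, no sorries.

The REGULAR family (rules A1/A2) with resources = class-SETS `T` and capacity `C_T := Σ_{δ valid for T} Π_{X∈T} O X (δ X)`.  A regular unit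
`(S, H)` comes with a REGULAR TRIPLE `(M, E₁, E₂)`: `M = {q₁, q₂} ∉ F` (middle), `E₁ = {q₁, f₁}`, `E₂ = {q₂, f₂} ∈ F` with `q₁, q₂, f₁, f₂ ≠ r`,
`f₁ ∉ {q₁,q₂}`, `f₂ ∉ {q₁,q₂}`, the hub and the partner being `M, E₁` (in some order, both in `S`) and `E₂` dominating one of them
(R1: `M` = hub, `E₂ = N_p(hub)`; R2: `M` = partner, `E₂ = N_s(partner)`).  The two canonical designations `(M→q₁, E₁→f₁, E₂→q₂)` and
`(M→q₂, E₁→q₁, E₂→f₂)` are valid and complementary, so `8·θ_hub·θ_partner ≤ C_T` (`balanced_word_cap_ge`); at most four claimant pairs per `T`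
(`card_pairs_le_four`), hence (`family_load_le`) the family is bounded by `(4/8)·Σ_{T regular triple} C_T`.

* `StarSet.regular_triple_le_cap` — `8·θ_X·θ_Y ≤ C_T` for hub/partner `{X, Y} = {M, E₁}`, `θ_X ≤ θ_{E₂}`;
* `StarSet.familyReg_bound` — `Σ_{u∈U} W(S_u) ≤ (1/2)·Σ_{T ∈ REGT} C_T` for any `REGT` containing all regular triples
  (kept as a parameter: the deep existential as a `Finset.filter` predicate makes elaboration of membership proofs time out).
-/

namespace Summit.CriticalPhenomena.PercolationContinuityZ3.Theorems

open Finset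
open scoped BigOperators Classical

namespace StarSet

variable {ι V : Type*} [Fintype ι] [DecidableEq ι] [DecidableEq V]

/-- **Canonical designations of a regular triple: `8·θ_X·θ_Y ≤ C_T`** for `T = {M, E₁, E₂}` as in the file header, `{X, Y} = {M, E₁}` and
`θ_X ≤ θ_{E₂}`. -/
theorem regular_triple_le_cap (P P' : ι → V) (r : V)
    (θ : ι → ℝ) (hθ0 : ∀ X, 0 ≤ θ X) (O : ι → V → ℝ) (hO0 : ∀ X d, 0 ≤ O X d) (Φ : ι → ℝ)
    (hO2 : ∀ X, Φ X ^ 2 ≤ O X (P X) * O X (P' X)) (hΦ4 : ∀ X, 4 * θ X ≤ Φ X) (hΦsq : ∀ X, θ X ≤ Φ X ^ 2)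
    {q₁ q₂ f₁ f₂ : V} (hq : q₁ ≠ q₂) (hf₁q₁ : f₁ ≠ q₁) (hf₁q₂ : f₁ ≠ q₂) (hf₂q₁ : f₂ ≠ q₁) (hf₂q₂ : f₂ ≠ q₂)
    (hq₁r : q₁ ≠ r) (hq₂r : q₂ ≠ r) (hf₁r : f₁ ≠ r) (hf₂r : f₂ ≠ r)
    {M E₁ E₂ : ι} (hM : (s(P M, P' M) : Sym2 V) = s(q₁, q₂)) (hE₁ : (s(P E₁, P' E₁) : Sym2 V) = s(q₁, f₁))
    (hE₂ : (s(P E₂, P' E₂) : Sym2 V) = s(q₂, f₂))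
    {X Y : ι} (hXY : (X = M ∧ Y = E₁) ∨ (X = E₁ ∧ Y = M)) (hdom : θ X ≤ θ E₂) :
    8 * (θ X * θ Y) ≤
      ∑ δ ∈ (univ : Finset (ι → Bool)).filter (fun δ => (∀ K ∉ ({M, E₁, E₂} : Finset ι), δ K = false) ∧
          3 ≤ (({M, E₁, E₂} : Finset ι).image fun K => if δ K then P K else P' K).card ∧
          r ∉ ({M, E₁, E₂} : Finset ι).image fun K => if δ K then P K else P' K),
        ∏ K ∈ ({M, E₁, E₂} : Finset ι), O K (if δ K then P K else P' K) := by
  -- distinct classes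
  have hME₁ : M ≠ E₁ := by
    intro h
    have h' : (s(q₁, q₂) : Sym2 V) = s(q₁, f₁) := by rw [← hM, ← hE₁, h]
    rcases Sym2.eq_iff.1 h' with ⟨_, h2⟩ | ⟨h1, _⟩
    · exact hf₁q₂ h2.symm
    · exact hf₁q₁ h1.symm
  have hME₂ : M ≠ E₂ := by
    intro h
    have h' : (s(q₁, q₂) : Sym2 V) = s(q₂, f₂) := by rw [← hM, ← hE₂, h]
    rcases Sym2.eq_iff.1 h' with ⟨h1, _⟩ | ⟨h1, _⟩
    · exact hq h1
    · exact hf₂q₁ h1.symm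
  have hE₁E₂ : E₁ ≠ E₂ := by
    intro h
    have h' : (s(q₁, f₁) : Sym2 V) = s(q₂, f₂) := by rw [← hE₁, ← hE₂, h]
    rcases Sym2.eq_iff.1 h' with ⟨h1, _⟩ | ⟨h1, _⟩
    · exact hq h1
    · exact hf₂q₁ h1.symm
  have hMnot : M ∉ ({E₁, E₂} : Finset ι) := by simp [hME₁, hME₂]
  -- ports
  have hMq₁ : P M = q₁ ∨ P' M = q₁ := (ports_iff_of_pair P P' hM q₁).2 (Or.inl rfl)
  have hMq₂ : P M = q₂ ∨ P' M = q₂ := (ports_iff_of_pair P P' hM q₂).2 (Or.inr rfl)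
  have hE₁q₁ : P E₁ = q₁ ∨ P' E₁ = q₁ := (ports_iff_of_pair P P' hE₁ q₁).2 (Or.inl rfl)
  have hE₁f₁ : P E₁ = f₁ ∨ P' E₁ = f₁ := (ports_iff_of_pair P P' hE₁ f₁).2 (Or.inr rfl)
  have hE₂q₂ : P E₂ = q₂ ∨ P' E₂ = q₂ := (ports_iff_of_pair P P' hE₂ q₂).2 (Or.inl rfl)
  have hE₂f₂ : P E₂ = f₂ ∨ P' E₂ = f₂ := (ports_iff_of_pair P P' hE₂ f₂).2 (Or.inr rfl)
  -- the two canonical designations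
  set δA : ι → Bool := fun K => if K = M then decide (P M = q₁) else if K = E₁ then decide (P E₁ = f₁)
    else if K = E₂ then decide (P E₂ = q₂) else false with hδA
  set δB : ι → Bool := fun K => if K = M then decide (P M = q₂) else if K = E₁ then decide (P E₁ = q₁)
    else if K = E₂ then decide (P E₂ = f₂) else false with hδB
  have hAM : (if δA M then P M else P' M) = q₁ := by simp only [hδA, if_pos rfl]; exact pick_port_eq P P' hMq₁
  have hAE₁ : (if δA E₁ then P E₁ else P' E₁) = f₁ := by
    simp only [hδA, if_neg hME₁.symm]; exact pick_port_eq P P' hE₁f₁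
  have hAE₂ : (if δA E₂ then P E₂ else P' E₂) = q₂ := by
    simp only [hδA, if_neg hME₂.symm, if_neg hE₁E₂.symm]; exact pick_port_eq P P' hE₂q₂
  have hBM : (if δB M then P M else P' M) = q₂ := by simp only [hδB, if_pos rfl]; exact pick_port_eq P P' hMq₂
  have hBE₁ : (if δB E₁ then P E₁ else P' E₁) = q₁ := by
    simp only [hδB, if_neg hME₁.symm]; exact pick_port_eq P P' hE₁q₁
  have hBE₂ : (if δB E₂ then P E₂ else P' E₂) = f₂ := by
    simp only [hδB, if_neg hME₂.symm, if_neg hE₁E₂.symm]; exact pick_port_eq P P' hE₂f₂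
  -- validity
  have himg : ∀ (δ : ι → Bool) (x y z : V), (if δ M then P M else P' M) = x → (if δ E₁ then P E₁ else P' E₁) = y →
      (if δ E₂ then P E₂ else P' E₂) = z →
      (({M, E₁, E₂} : Finset ι).image fun K => if δ K then P K else P' K) = {x, y, z} := by
    intro δ x y z h1 h2 h3
    rw [image_insert, image_insert, image_singleton, h1, h2, h3]
  have hvalid : ∀ (δ : ι → Bool) (x y z : V), x ≠ y → x ≠ z → y ≠ z → x ≠ r → y ≠ r → z ≠ r →
      (∀ K ∉ ({M, E₁, E₂} : Finset ι), δ K = false) →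
      (if δ M then P M else P' M) = x → (if δ E₁ then P E₁ else P' E₁) = y → (if δ E₂ then P E₂ else P' E₂) = z →
      δ ∈ (univ : Finset (ι → Bool)).filter (fun δ => (∀ K ∉ ({M, E₁, E₂} : Finset ι), δ K = false) ∧
          3 ≤ (({M, E₁, E₂} : Finset ι).image fun K => if δ K then P K else P' K).card ∧
          r ∉ ({M, E₁, E₂} : Finset ι).image fun K => if δ K then P K else P' K) := by
    intro δ x y z hxy hxz hyz hxr hyr hzr hoff h1 h2 h3
    rw [mem_filter, himg δ x y z h1 h2 h3]
    refine ⟨mem_univ _, hoff, ?_, ?_⟩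
    · rw [card_insert_of_notMem (by simp [hxy, hxz]), card_pair hyz]
    · simp [Ne.symm hxr, Ne.symm hyr, Ne.symm hzr]
  have hoffA : ∀ K ∉ ({M, E₁, E₂} : Finset ι), δA K = false := by
    intro K hK
    simp only [mem_insert, mem_singleton, not_or] at hK
    simp only [hδA, if_neg hK.1, if_neg hK.2.1, if_neg hK.2.2]
  have hoffB : ∀ K ∉ ({M, E₁, E₂} : Finset ι), δB K = false := by
    intro K hK
    simp only [mem_insert, mem_singleton, not_or] at hK
    simp only [hδB, if_neg hK.1, if_neg hK.2.1, if_neg hK.2.2]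
  have hmemA := hvalid δA q₁ f₁ q₂ hf₁q₁.symm hq hf₁q₂ hq₁r hf₁r hq₂r hoffA hAM hAE₁ hAE₂
  have hmemB := hvalid δB q₂ q₁ f₂ hq.symm hf₂q₂.symm hf₂q₁.symm hq₂r hq₁r hf₂r hoffB hBM hBE₁ hBE₂
  have hne : δA ≠ δB := by
    intro h
    have : (if δA M then P M else P' M) = (if δB M then P M else P' M) := by rw [h]
    rw [hAM, hBM] at this
    exact hq this
  have hsub : ({δA, δB} : Finset (ι → Bool)) ⊆ (univ : Finset (ι → Bool)).filter (fun δ =>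
      (∀ K ∉ ({M, E₁, E₂} : Finset ι), δ K = false) ∧
        3 ≤ (({M, E₁, E₂} : Finset ι).image fun K => if δ K then P K else P' K).card ∧
        r ∉ ({M, E₁, E₂} : Finset ι).image fun K => if δ K then P K else P' K) := by
    intro δ hδ
    rcases mem_insert.1 hδ with rfl | hδ
    · exact hmemA
    · rw [mem_singleton.1 hδ]; exact hmemB
  refine le_trans ?_ (sum_le_sum_of_subset_of_nonneg hsub fun δ _ _ => prod_nonneg fun K _ => hO0 _ _)
  rw [sum_pair hne, prod_insert hMnot, prod_pair hE₁E₂, prod_insert hMnot, prod_pair hE₁E₂,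
    hAM, hAE₁, hAE₂, hBM, hBE₁, hBE₂]
  have hΦ0 : ∀ K, 0 ≤ Φ K := fun K => by linarith [hΦ4 K, hθ0 K]
  -- complementary factors per class
  have hOM : Φ M ^ 2 ≤ O M q₁ * O M q₂ := odds_pair_of_ports P P' O Φ hM (hO2 M)
  have hOE₁ : Φ E₁ ^ 2 ≤ O E₁ f₁ * O E₁ q₁ := by
    rw [mul_comm]; exact odds_pair_of_ports P P' O Φ hE₁ (hO2 E₁)
  have hOE₂ : Φ E₂ ^ 2 ≤ O E₂ q₂ * O E₂ f₂ := odds_pair_of_ports P P' O Φ hE₂ (hO2 E₂)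
  rcases hXY with ⟨rfl, rfl⟩ | ⟨rfl, rfl⟩
  · -- hub `M`, partner `E₁`
    have h8 := balanced_word_cap_ge (θ X) (θ Y) (θ E₂) (Φ X) (Φ Y) (Φ E₂) (O X q₁) (O X q₂) (O Y f₁) (O Y q₁)
      (O E₂ q₂) (O E₂ f₂) (hθ0 X) (hθ0 Y) hdom (hΦ0 X) (hΦ0 E₂) (hΦ4 Y) (hΦsq X) (hΦsq E₂)
      (hO0 _ _) (hO0 _ _) (hO0 _ _) (hO0 _ _) (hO0 _ _) (hO0 _ _) hOM hOE₁ hOE₂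
    nlinarith [h8]
  · -- hub `E₁`, partner `M`
    have h8 := balanced_word_cap_ge (θ X) (θ Y) (θ E₂) (Φ X) (Φ Y) (Φ E₂) (O X f₁) (O X q₁) (O Y q₁) (O Y q₂)
      (O E₂ q₂) (O E₂ f₂) (hθ0 X) (hθ0 Y) hdom (hΦ0 X) (hΦ0 E₂) (hΦ4 Y) (hΦsq X) (hΦsq E₂)
      (hO0 _ _) (hO0 _ _) (hO0 _ _) (hO0 _ _) (hO0 _ _) (hO0 _ _) hOE₁ hOM hOE₂
    nlinarith [h8]

/-- **The regular family bound (U1-PROOF §3, §9; blueprint §C (reg), §F2, §G).**  For any finite set `U` of units `(S, H)` with `H ∈ S`, `H ∉ F`,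
and a regular triple `(M, E₁, E₂)` (see the file header) with `M, E₁ ∈ S`, `E₂ ∈ F`, `H ∈ {M, E₁}` and `E₂` dominating `M` or `E₁`:
`Σ_{u∈U} W(S_u) ≤ (1/2)·Σ_{T regular triple} C_T`. -/
theorem familyReg_bound (P P' : ι → V) (r : V) (F : Finset ι)
    (θ : ι → ℝ) (hθ0 : ∀ X, 0 ≤ θ X) (hθ1 : ∀ X, θ X ≤ 1) (O : ι → V → ℝ) (hO0 : ∀ X d, 0 ≤ O X d) (Φ : ι → ℝ)
    (hO2 : ∀ X, Φ X ^ 2 ≤ O X (P X) * O X (P' X)) (hΦ4 : ∀ X, 4 * θ X ≤ Φ X) (hΦsq : ∀ X, θ X ≤ Φ X ^ 2)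
    (REGT : Finset (Finset ι))
    (hREGT : ∀ T : Finset ι, (∃ M E₁ E₂ : ι, ∃ q₁ q₂ f₁ f₂ : V,
          M ∉ F ∧ (s(P M, P' M) : Sym2 V) = s(q₁, q₂) ∧ (s(P E₁, P' E₁) : Sym2 V) = s(q₁, f₁) ∧
          (s(P E₂, P' E₂) : Sym2 V) = s(q₂, f₂) ∧ q₁ ≠ q₂ ∧ f₁ ≠ q₁ ∧ f₁ ≠ q₂ ∧ f₂ ≠ q₁ ∧ f₂ ≠ q₂ ∧
          q₁ ≠ r ∧ q₂ ≠ r ∧ f₁ ≠ r ∧ f₂ ≠ r ∧ T = {M, E₁, E₂}) → T ∈ REGT)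
    (U : Finset (Finset ι × ι))
    (hU : ∀ u ∈ U, u.2 ∈ u.1 ∧ u.2 ∉ F ∧ ∃ M E₁ E₂ : ι, ∃ q₁ q₂ f₁ f₂ : V,
      M ∉ F ∧ (s(P M, P' M) : Sym2 V) = s(q₁, q₂) ∧ (s(P E₁, P' E₁) : Sym2 V) = s(q₁, f₁) ∧
        (s(P E₂, P' E₂) : Sym2 V) = s(q₂, f₂) ∧ q₁ ≠ q₂ ∧ f₁ ≠ q₁ ∧ f₁ ≠ q₂ ∧ f₂ ≠ q₁ ∧ f₂ ≠ q₂ ∧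
        q₁ ≠ r ∧ q₂ ≠ r ∧ f₁ ≠ r ∧ f₂ ≠ r ∧
        M ∈ u.1 ∧ E₁ ∈ u.1 ∧ E₂ ∈ F ∧ (u.2 = M ∨ u.2 = E₁) ∧ (θ M ≤ θ E₂ ∨ θ E₁ ≤ θ E₂)) :
    ∑ u ∈ U, ((∏ k ∈ u.1, θ k) * ∏ k ∈ univ \ u.1, (1 - θ k)) ≤
      (1 / 2) * ∑ T ∈ REGT,
        ∑ δ ∈ (univ : Finset (ι → Bool)).filter (fun δ => (∀ K ∉ T, δ K = false) ∧
            3 ≤ (T.image fun K => if δ K then P K else P' K).card ∧ r ∉ T.image fun K => if δ K then P K else P' K),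
          ∏ K ∈ T, O K (if δ K then P K else P' K) := by
  -- capacity of a class-set
  set C : Finset ι → ℝ := fun T => ∑ δ ∈ (univ : Finset (ι → Bool)).filter (fun δ => (∀ K ∉ T, δ K = false) ∧
      3 ≤ (T.image fun K => if δ K then P K else P' K).card ∧ r ∉ T.image fun K => if δ K then P K else P' K),
    ∏ K ∈ T, O K (if δ K then P K else P' K) with hC
  have hC0 : ∀ T, 0 ≤ C T := fun T => sum_nonneg fun δ _ => prod_nonneg fun K _ => hO0 _ _
  -- per unit: the triple, the partner, the capacity bound
  have hex : ∀ u ∈ U, ∃ T : Finset ι, ∃ Q : ι, Q ∈ u.1 ∧ Q ≠ u.2 ∧ u.2 ∈ T ∧ Q ∈ T ∧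
      (∃ M E₁ E₂ : ι, ∃ q₁ q₂ f₁ f₂ : V,
          M ∉ F ∧ (s(P M, P' M) : Sym2 V) = s(q₁, q₂) ∧ (s(P E₁, P' E₁) : Sym2 V) = s(q₁, f₁) ∧
          (s(P E₂, P' E₂) : Sym2 V) = s(q₂, f₂) ∧ q₁ ≠ q₂ ∧ f₁ ≠ q₁ ∧ f₁ ≠ q₂ ∧ f₂ ≠ q₁ ∧ f₂ ≠ q₂ ∧
          q₁ ≠ r ∧ q₂ ≠ r ∧ f₁ ≠ r ∧ f₂ ≠ r ∧ T = {M, E₁, E₂}) ∧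
      8 * (θ u.2 * θ Q) ≤ C T ∧ T.card = 3 ∧ (∃ N ∈ T, N ∈ F) := by
    intro u hu
    obtain ⟨hHS, hHF, M, E₁, E₂, q₁, q₂, f₁, f₂, hMF, hM, hE₁, hE₂, hq, hf₁q₁, hf₁q₂, hf₂q₁, hf₂q₂, hq₁r, hq₂r, hf₁r, hf₂r,
      hMS, hE₁S, hE₂F, hhub, hdom⟩ := hU u hu
    have hME₁ : M ≠ E₁ := by
      intro h
      have h' : (s(q₁, q₂) : Sym2 V) = s(q₁, f₁) := by rw [← hM, ← hE₁, h]
      rcases Sym2.eq_iff.1 h' with ⟨_, h2⟩ | ⟨h1, _⟩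
      · exact hf₁q₂ h2.symm
      · exact hf₁q₁ h1.symm
    have hME₂ : M ≠ E₂ := by
      intro h
      have h' : (s(q₁, q₂) : Sym2 V) = s(q₂, f₂) := by rw [← hM, ← hE₂, h]
      rcases Sym2.eq_iff.1 h' with ⟨h1, _⟩ | ⟨h1, _⟩
      · exact hq h1
      · exact hf₂q₁ h1.symm
    have hE₁E₂ : E₁ ≠ E₂ := by
      intro h
      have h' : (s(q₁, f₁) : Sym2 V) = s(q₂, f₂) := by rw [← hE₁, ← hE₂, h]
      rcases Sym2.eq_iff.1 h' with ⟨h1, _⟩ | ⟨h1, _⟩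
      · exact hq h1
      · exact hf₂q₁ h1.symm
    have hMnot : M ∉ ({E₁, E₂} : Finset ι) := by simp [hME₁, hME₂]
    have hcard : ({M, E₁, E₂} : Finset ι).card = 3 := by rw [card_insert_of_notMem hMnot, card_pair hE₁E₂]
    have hT : ∃ M' E₁' E₂' : ι, ∃ q₁' q₂' f₁' f₂' : V,
        M' ∉ F ∧ (s(P M', P' M') : Sym2 V) = s(q₁', q₂') ∧ (s(P E₁', P' E₁') : Sym2 V) = s(q₁', f₁') ∧
        (s(P E₂', P' E₂') : Sym2 V) = s(q₂', f₂') ∧ q₁' ≠ q₂' ∧ f₁' ≠ q₁' ∧ f₁' ≠ q₂' ∧ f₂' ≠ q₁' ∧ f₂' ≠ q₂' ∧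
        q₁' ≠ r ∧ q₂' ≠ r ∧ f₁' ≠ r ∧ f₂' ≠ r ∧ ({M, E₁, E₂} : Finset ι) = {M', E₁', E₂'} :=
      ⟨M, E₁, E₂, q₁, q₂, f₁, f₂, hMF, hM, hE₁, hE₂, hq, hf₁q₁, hf₁q₂, hf₂q₁, hf₂q₂, hq₁r, hq₂r, hf₁r, hf₂r, rfl⟩
    -- capacity bound for (hub, partner)
    -- the capacity bound for the two possible dominated classes
    have hcapM : θ M ≤ θ E₂ → 8 * (θ M * θ E₁) ≤ C {M, E₁, E₂} := fun hd => by
      have h := regular_triple_le_cap P P' r θ hθ0 O hO0 Φ hO2 hΦ4 hΦsq hq hf₁q₁ hf₁q₂ hf₂q₁ hf₂q₂ hq₁r hq₂r hf₁r hf₂r hM hE₁ hE₂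
        (X := M) (Y := E₁) (Or.inl ⟨rfl, rfl⟩) hd
      simp only [hC]; exact h
    have hcapE : θ E₁ ≤ θ E₂ → 8 * (θ E₁ * θ M) ≤ C {M, E₁, E₂} := fun hd => by
      have h := regular_triple_le_cap P P' r θ hθ0 O hO0 Φ hO2 hΦ4 hΦsq hq hf₁q₁ hf₁q₂ hf₂q₁ hf₂q₂ hq₁r hq₂r hf₁r hf₂r hM hE₁ hE₂
        (X := E₁) (Y := M) (Or.inr ⟨rfl, rfl⟩) hd
      simp only [hC]; exact h
    have hcap : 8 * (θ M * θ E₁) ≤ C {M, E₁, E₂} := by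
      rcases hdom with hd | hd
      · exact hcapM hd
      · have h := hcapE hd
        rwa [mul_comm (θ E₁) (θ M)] at h
    rcases hhub with hH | hH
    · -- hub `M`, partner `E₁`
      refine ⟨{M, E₁, E₂}, E₁, hE₁S, by rw [hH]; exact hME₁.symm, by rw [hH]; simp, by simp, hT, ?_, hcard, ⟨E₂, by simp, hE₂F⟩⟩
      rw [hH]; exact hcap
    · -- hub `E₁`, partner `M`
      refine ⟨{M, E₁, E₂}, M, hMS, by rw [hH]; exact hME₁, by rw [hH]; simp, by simp, hT, ?_, hcard, ⟨E₂, by simp, hE₂F⟩⟩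
      rw [hH, mul_comm (θ E₁) (θ M)]; exact hcap
  -- resource and partner maps
  obtain ⟨res, part, hspec⟩ : ∃ (res : Finset ι × ι → Finset ι) (part : Finset ι × ι → ι), ∀ u ∈ U,
      part u ∈ u.1 ∧ part u ≠ u.2 ∧ u.2 ∈ res u ∧ part u ∈ res u ∧
      (∃ M E₁ E₂ : ι, ∃ q₁ q₂ f₁ f₂ : V,
          M ∉ F ∧ (s(P M, P' M) : Sym2 V) = s(q₁, q₂) ∧ (s(P E₁, P' E₁) : Sym2 V) = s(q₁, f₁) ∧
          (s(P E₂, P' E₂) : Sym2 V) = s(q₂, f₂) ∧ q₁ ≠ q₂ ∧ f₁ ≠ q₁ ∧ f₁ ≠ q₂ ∧ f₂ ≠ q₁ ∧ f₂ ≠ q₂ ∧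
          q₁ ≠ r ∧ q₂ ≠ r ∧ f₁ ≠ r ∧ f₂ ≠ r ∧ res u = {M, E₁, E₂}) ∧
      8 * (θ u.2 * θ (part u)) ≤ C (res u) ∧ (res u).card = 3 ∧ (∃ N ∈ res u, N ∈ F) :=
    ⟨fun u => if h : u ∈ U then (hex u h).choose else ∅,
     fun u => if h : u ∈ U then (hex u h).choose_spec.choose else u.2,
     fun u hu => by simp only [dif_pos hu]; exact (hex u hu).choose_spec.choose_spec⟩
  -- the generic family bound with (m, c) = (4, 8)
  have hmain := family_load_le θ hθ0 hθ1 U res (fun u => (u.2, part u)) (fun u => {u.2, part u}) C (fun u _ => hC0 _) 4 8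
    (by norm_num)
    (fun u hu => by
      intro K hK
      rcases mem_insert.1 hK with rfl | hK
      · exact (hU u hu).1
      · rw [mem_singleton.1 hK]; exact (hspec u hu).1)
    (fun u _ v _ _ hk => by
      obtain ⟨h1, h2⟩ := Prod.mk.inj hk
      simp only [h1, h2])
    (fun u _ v _ _ hk h1 => Prod.ext h1 (Prod.mk.inj hk).1)
    (fun u hu => by
      have h := (hspec u hu).2.2.2.2.2.1
      rw [prod_pair (hspec u hu).2.1.symm, le_div_iff₀ (by norm_num : (0:ℝ) < 8)]
      linarith)
    (fun T hT => by
      obtain ⟨u₀, hu₀, hu₀T⟩ := mem_image.1 hT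
      obtain ⟨N, hNT, hNF⟩ := (hspec u₀ hu₀).2.2.2.2.2.2.2
      have hsub : (U.filter (fun u => res u = T)).image (fun u => (u.2, part u)) ⊆
          (T ×ˢ T).filter (fun p : ι × ι => p.1 ≠ p.2 ∧ p.1 ∉ F) := by
        intro p hp
        obtain ⟨u, hu, rfl⟩ := mem_image.1 hp
        have huU : u ∈ U := (mem_filter.1 hu).1
        have huT : res u = T := (mem_filter.1 hu).2
        rw [mem_filter, mem_product]
        refine ⟨⟨?_, ?_⟩, (hspec u huU).2.1.symm, (hU u huU).2.1⟩
        · rw [← huT]; exact (hspec u huU).2.2.1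
        · rw [← huT]; exact (hspec u huU).2.2.2.1
      refine (card_le_card hsub).trans ?_
      rw [← hu₀T]
      exact card_pairs_le_four F (res u₀) hNT hNF (hspec u₀ hu₀).2.2.2.2.2.2.1)
  refine hmain.trans ?_
  rw [show ((4 : ℕ) : ℝ) / 8 = 1 / 2 by norm_num]
  refine mul_le_mul_of_nonneg_left (sum_le_sum_of_subset_of_nonneg (fun T hT => ?_) fun T _ _ => hC0 T) (by norm_num)
  obtain ⟨u, hu, rfl⟩ := mem_image.1 hT
  exact hREGT _ (hspec u hu).2.2.2.2.1

end StarSet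

end Summit.CriticalPhenomena.PercolationContinuityZ3.Theorems
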